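import Summits.BirchSwinnertonDyer.BirchSwinnertonDyer.Theorems.PublishedInputsGreenbergLocalSurjectivityAtPHTwo
import Summits.BirchSwinnertonDyer.BirchSwinnertonDyer.Theorems.ByReductionTypeAtTwoGoodOrdTowerControlDualBound
import Literature.NumberTheory.GaloisRepresentations.CohomologicalDimensionProofs
import HarnessLib

set_option linter.dupNamespace false -- `…BirchSwinnertonDyer.BirchSwinnertonDyer…` is the cell's nested layout (D-0017)
set_option autoImplicit false

/-!
# Greenberg LNM 1716 Lemma 3.4 at the layers `n ≥ 1`, brick 9: `H²(H_n, Ê[p^∞]) = 0` for the open subgroup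
# `H_n = Gal(K̄_v/K_{v,n})` (the layer-`n` form of gen 4's `H²(K_v, Ê[p^∞]) = 0`)

Seat `bsd-inputs-k4-p1` (gen 6; LADDER-BSD D-0154 KEY (147)(f) «prove the printed input», row 1 K4 INPUTS; Greenberg
1999), `--supports stmt-BirchSwinnertonDyer-20309`. THEOREMS ONLY (no definition, no named fact, no `sorry`).

Greenberg, LNM 1716 (1999), §4 p. 108: "`Gal((F_∞)_η/(F_n)_{v_n})` has `p`-cohomological dimension `1`, looking at …
`λ_v` for `v ∣ p`"; the coinvariant vanishing `(E(K_{∞,η}) ⊗ ℚ_p/ℤ_p)_{Γ_{v_n}} = 0` at the LAYER `n` needs, as at the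
layer `0` (gen 4, `InputsGreenbergLocalAtP.subsingleton_continuousCohomology_two_formalTorsion`), the vanishing of
`H²` of the formal torsion `C = Ê[p^∞]`, now over the open subgroup `H_n ≤ Γ_{K_v}`. Same proof with the group replaced:
`cd_p(H) ≤ 2` for a closed `H ≤ Γ_{K_v}` (`groupCdLE_subgroup_of_isClosed_holds`, Serre I §3.3 Prop. 14), `C` `p`-primary
and `p`-divisible, and the uniform bound `#H²(H, C[p^k]) ≤ #Hom_H(C[p^k], μ_{p^k}) ≤ #SF` (cell bsd-2adic's BRICK D
`GoodOrdTower.finite_and_natCard_two_restrict_le` + `natCard_equivariant_le_card_filter` with `τ ∈ H` + the Frobenius count).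

* `subsingleton_continuousCohomology_two_restrict_formalTorsion` — **`H²(H, C) = 0`** for every open normal
  `H ≤ Γ_{K_v}` containing `τ`.

HONEST FRAMING: a local TOOL theorem; closes no item; no summit statement is proved; BSD is not proved by any of this.

References: [GreenbergLNM1716] §2 pp. 70–75, §4 p. 108; [MilneADT2006] I Cor. 2.3, I §3; [SerreGaloisCohomology1997]
I §3.3 Prop. 14, II §4.3 Prop. 12, II §5.2 Thm. 2.
-/

noncomputable section

open scoped Classical NNReal

universe u

namespace Summit.BirchSwinnertonDyer.BirchSwinnertonDyer.Theorems.InputsGreenbergLemma34Layer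

open CategoryTheory NumberField IsDedekindDomain Field
  Literature.NumberTheory.GaloisRepresentations Literature.NumberTheory.GaloisRepresentations.DiscreteGaloisModule
  IsDedekindDomain.HeightOneSpectrum _root_.TopRep _root_.ContRepresentation _root_.ContinuousCohomology WeierstrassCurve
  Summit.BirchSwinnertonDyer.BirchSwinnertonDyer.Theorems.GoodOrdTower
open Literature.NumberTheory.EllipticCurves hiding subgroupIncl

variable {K : Type u} [Field K] [NumberField K] (v : HeightOneSpectrum (𝓞 K)) (W : WeierstrassCurve K) [W.IsElliptic]
  {p : ℕ} [hp : Fact p.Prime]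

set_option maxHeartbeats 3200000 in
/-- **`H²(H, Ê[p^∞]) = 0` for an open normal subgroup `H ≤ Γ_{K_v}` containing the Frobenius `τ`** (the layer-`n`
form of gen 4's `subsingleton_continuousCohomology_two_formalTorsion`: `H = Gal(K̄_v/K_{v,n})`). Same abstract
`red₀`-currency: `K` a number field, `v` a finite place, `W/K` elliptic, `red₀ : E(K̄_v) →+ B` with `Γ_{K_v}`-stable and
`p`-divisible kernel carrying the ordinary filtration, `τ` fixing the `p`-power roots of unity with `τ`-fixed reductions in
the finite set `SF`, `C = ker red₀ ∩ E(K̄_v)[p^∞]` carried by `ρ`. Then `H²(H, C)` (continuous cohomology of the restriction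
of `ρ` to `H`) is a singleton: `cd_p(H) ≤ 2` (closed subgroup of `Γ_{K_v}`), `C` `p`-primary and `p`-divisible, and
`#H²(H, C[p^k]) ≤ #Hom_H(C[p^k], μ) ≤ #SF` uniformly in `k` (cell bsd-2adic's BRICK D + Frobenius count).
[cite: GreenbergLNM1716, §2 pp. 70–75 and §4 p. 108] [cite: MilneADT2006, I Cor. 2.3 and §3]
[cite: SerreGaloisCohomology1997, I §3.3 Prop. 14, II §4.3 Prop. 12] -/
theorem subsingleton_continuousCohomology_two_restrict_formalTorsion
    {B : Type*} [AddCommGroup B] (red₀ : localPoints W (v.adicCompletion K) →+ B)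
    (hstab : ∀ (σ : absoluteGaloisGroup (v.adicCompletion K)) (Q : localPoints W (v.adicCompletion K)),
      red₀ Q = 0 → red₀ (σ • Q) = 0)
    (hdiv₁ : ∀ a : localPoints W (v.adicCompletion K), red₀ a = 0 →
      ∃ b : localPoints W (v.adicCompletion K), red₀ b = 0 ∧ p • b = a)
    (hgenr : ∀ r : ℕ, ∃ P₁ : localPoints W (v.adicCompletion K), red₀ P₁ = 0 ∧ addOrderOf P₁ = p ^ r ∧
      ∀ P : localPoints W (v.adicCompletion K), red₀ P = 0 → ((p ^ r : ℕ) : ℤ) • P = 0 → ∃ c : ℕ, P = c • P₁)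
    (hsurj : ∀ (r : ℕ) (y : B), ((p ^ r : ℕ) : ℤ) • y = 0 →
      ∃ x : localPoints W (v.adicCompletion K), ((p ^ r : ℕ) : ℤ) • x = 0 ∧ red₀ x = y)
    {τ : absoluteGaloisGroup (v.adicCompletion K)}
    (hτfix : ∀ (r : ℕ) (ξ : AlgebraicClosure (v.adicCompletion K)), ξ ^ p ^ r = 1 → τ • ξ = ξ)
    (SF : Finset B) (hSF : ∀ Q : localPoints W (v.adicCompletion K), red₀ (τ • Q) = red₀ Q → red₀ Q ∈ SF)
    (C : AddSubgroup (localPoints W (v.adicCompletion K)))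
    (hC : ∀ a, a ∈ C ↔ red₀ a = 0 ∧ ∃ e : ℕ, p ^ e • a = 0)
    (ρ : ContinuousRep (absoluteGaloisGroup (v.adicCompletion K)) ℤ C)
    (hρ : ∀ (σ : absoluteGaloisGroup (v.adicCompletion K)) (c : C),
      ((ρ σ c : C) : localPoints W (v.adicCompletion K)) = σ • (c : localPoints W (v.adicCompletion K)))
    (H : Subgroup (absoluteGaloisGroup (v.adicCompletion K))) [H.Normal]
    (hHo : IsOpen (H : Set (absoluteGaloisGroup (v.adicCompletion K)))) (hτH : τ ∈ H) :
    Subsingleton (continuousCohomology 2 (ρ.restrict (subgroupIncl H)).toTopRep) := by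
  -- notation
  let E := v.adicCompletion K
  let P : Type u := localPoints W E
  let Γ := absoluteGaloisGroup E
  haveI : CompactSpace Γ := absoluteGaloisGroup_compactSpace E
  haveI : T2Space Γ := krullTopology_t2
  -- `C` is `p`-primary and `p`-divisible
  have hprim : IsPrimaryTorsion p C := fun a ↦ by
    obtain ⟨-, e, he⟩ := (hC a).mp a.2
    exact ⟨e, Subtype.ext (by rw [AddSubgroupClass.coe_nsmul, he, ZeroMemClass.coe_zero])⟩
  have hdiv : ∀ a : C, ∃ b : C, p • b = a := fun a ↦ by
    obtain ⟨ha0, e, he⟩ := (hC a).mp a.2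
    obtain ⟨b, hb0, hba⟩ := hdiv₁ a ha0
    refine ⟨⟨b, (hC b).mpr ⟨hb0, e + 1, ?_⟩⟩, Subtype.ext (by rw [AddSubgroupClass.coe_nsmul]; exact hba)⟩
    rw [pow_succ, mul_smul, hba, he]
  -- the bound `#H²(K_v, C[p^k]) ≤ #SF` at every depth
  have hHc : IsClosed (H : Set Γ) := Subgroup.isClosed_of_isOpen _ hHo
  have hk : ∀ k : ℕ, Finite (continuousCohomology 2 ((ρ.restrict (subgroupIncl H)).torsionRep (p ^ k)).toTopRep) ∧
      Nat.card (continuousCohomology 2 ((ρ.restrict (subgroupIncl H)).torsionRep (p ^ k)).toTopRep) ≤ SF.card := by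
    intro k
    have hrep : (ρ.torsionRep (p ^ k)).restrict (subgroupIncl H) = (ρ.restrict (subgroupIncl H)).torsionRep (p ^ k) :=
      rfl
    rw [← hrep]
    -- the generator `P_k` of `ker red₀ ∩ E[p^k]`
    obtain ⟨Pk, hPk0, hPkord, hPkgen⟩ := hgenr k
    have hPk2 : p ^ k • Pk = 0 := by rw [← hPkord]; exact addOrderOf_nsmul_eq_zero Pk
    -- the Frobenius count (before any `CharZero K_v` enters the context)
    have hcnt := @WeierstrassCurve.card_filter_smul_nsmul_eq_le K _ W _ E _ _
      (charZero_of_injective_algebraMap (algebraMap K E).injective) p _ B _ red₀ τ hτfix hgenr hsurj SF hSF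
      k Pk hPk0 hPkord
    haveI : CharZero E := charZero_of_injective_algebraMap (algebraMap K E).injective
    -- the torsion module `Z = C[p^k]` and the embedding `ι : Z → E(K̄_v)`
    let Z : Type u := Submodule.torsionBy ℤ C ((p ^ k : ℕ) : ℤ)
    let ι : Z →+ P := C.subtype.comp (Submodule.torsionBy ℤ C ((p ^ k : ℕ) : ℤ)).subtype.toAddMonoidHom
    have hι : ∀ z : Z, ι z = ((z : C) : P) := fun _ ↦ rfl
    have hιinj : Function.Injective ι := fun a b hab ↦ Subtype.ext (Subtype.ext hab)
    have hZmem : ∀ z : Z, red₀ (ι z) = 0 ∧ p ^ k • ι z = 0 := fun z ↦ by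
      refine ⟨((hC _).mp (z : C).2).1, ?_⟩
      have h := (ContinuousRep.mem_torsionBy_nsmul_iff (p ^ k)).1 z.2
      have h' := congrArg (fun x : C ↦ (x : P)) h
      simp only [AddSubgroupClass.coe_nsmul, ZeroMemClass.coe_zero] at h'
      rw [hι]; exact h'
    have hPkC : Pk ∈ C := (hC Pk).mpr ⟨hPk0, k, hPk2⟩
    let Pz : Z := ⟨⟨Pk, hPkC⟩, (ContinuousRep.mem_torsionBy_nsmul_iff (p ^ k)).2
      (Subtype.ext (by rw [AddSubgroupClass.coe_nsmul, ZeroMemClass.coe_zero]; exact hPk2))⟩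
    have hιPz : ι Pz = Pk := rfl
    have hZgen : ∀ z : Z, ∃ i : ℕ, z = i • Pz := fun z ↦ by
      obtain ⟨c, hc⟩ := hPkgen (ι z) (hZmem z).1 (by rw [natCast_zsmul]; exact (hZmem z).2)
      exact ⟨c, hιinj (by rw [map_nsmul, hιPz]; exact hc)⟩
    have hPzord : addOrderOf Pz = p ^ k := by
      rw [← addOrderOf_injective ι hιinj Pz, hιPz]; exact hPkord
    -- `Z` is finite (cyclic on `Pz`)
    haveI hZfin : Finite Z := by
      haveI : Finite (AddSubgroup.zmultiples Pk) := Nat.finite_of_card_ne_zero (by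
        rw [Nat.card_zmultiples, hPkord]; exact pow_ne_zero k hp.out.ne_zero)
      refine Finite.of_injective (fun z : Z ↦ (⟨ι z, ?_⟩ : AddSubgroup.zmultiples Pk)) fun a b hab ↦ ?_
      · obtain ⟨i, rfl⟩ := hZgen z
        rw [map_nsmul, hιPz]
        exact AddSubgroup.nsmul_mem _ (AddSubgroup.mem_zmultiples Pk) i
      · exact hιinj (congrArg (fun y : AddSubgroup.zmultiples Pk ↦ (y : P)) hab)
    have hZk : ∀ z : Z, p ^ k • z = 0 := fun z ↦ hιinj (by rw [map_nsmul, map_zero]; exact (hZmem z).2)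
    -- the action on `Z`: `ι (ρ_k σ z) = σ • ι z`; `τ P_k = b P_k`
    have hρk : ∀ (σ : Γ) (z : Z), ι ((ρ.torsionRep (p ^ k)) σ z) = σ • ι z := fun σ z ↦ by
      rw [hι, hι, ContinuousRep.subrepresentation_apply_coe, hρ]
    obtain ⟨b, hb⟩ := hPkgen (τ • Pk) (hstab τ Pk hPk0) (by rw [natCast_zsmul, smul_comm, hPk2, smul_zero])
    have hb' : (ρ.torsionRep (p ^ k)) τ Pz = b • Pz := hιinj (by rw [hρk, map_nsmul, hιPz]; exact hb)
    -- `τ` acts trivially on `μ_{p^k}`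
    have hτω : ∀ z : MuCarrier E (p ^ k), mu E (p ^ k) τ z = z := by
      intro z
      have hu1 : (((MuCarrier.toAdditive z).toMul : (AlgebraicClosure E)ˣ) : AlgebraicClosure E) ^ p ^ k = 1 := by
        have h' := ((MuCarrier.toAdditive z).toMul).2
        rw [mem_rootsOfUnity] at h'
        rw [← Units.val_pow_eq_pow_val, h', Units.val_one]
      apply MuCarrier.toAdditive.injective
      rw [mu_apply_apply]
      refine congrArg Additive.ofMul (Subtype.ext (Units.ext ?_))
      rw [absoluteGaloisGroup.coe_smul_rootsOfUnity, Units.coe_smul]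
      exact hτfix k _ hu1
    haveI : NeZero (p ^ k) := ⟨pow_ne_zero k hp.out.ne_zero⟩
    -- BRICK D (cell bsd-2adic): `#H²(H, Z) ≤ #Hom_H(Z, μ_{p^k})` (Shapiro + local duality `(2,0)`)
    obtain ⟨hfin2, hD1⟩ := finite_and_natCard_two_restrict_le E H hHo (ρ.torsionRep (p ^ k)) (p := p) (k := k) hZk
    refine ⟨hfin2, hD1.trans ?_⟩
    -- equivariant maps out of the cyclic `Z`, then the Frobenius count
    have hD2 := natCard_equivariant_le_card_filter H (ρ.torsionRep (p ^ k)) (mu E (p ^ k))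
      (muEquivZMod E (p ^ k)) hPzord hZgen hτH hτω hb'
    refine hD2.trans (le_trans (Finset.card_le_card fun i hi ↦ ?_) hcnt)
    simp only [Finset.mem_filter] at hi ⊢
    refine ⟨hi.1, ?_⟩
    have h := congrArg ι hi.2
    rw [hρk, map_nsmul, hιPz] at h
    exact h
  haveI : CharZero E := charZero_of_injective_algebraMap (algebraMap K E).injective
  haveI : CompactSpace H := isCompact_iff_compactSpace.mp hHc.isCompact
  have hcdH : GroupCdLE H p 2 :=
    groupCdLE_subgroup_of_isClosed_holds Γ H hHc p 2 (groupCdLE_two_absoluteGaloisGroup E p)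
  exact subsingleton_two_of_divisible_of_natCard_le (ρ.restrict (subgroupIncl H)) hcdH hprim hdiv SF.card hk

end Summit.BirchSwinnertonDyer.BirchSwinnertonDyer.Theorems.InputsGreenbergLemma34Layer

end

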